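import Summits.HubbardSuperconductivity.HubbardSuperconductivity.Theorems.WidthHaldaneTubeTwistSeam

/-!
# The twisted plane waves of the labelled tube and the free (`U = 0`) floor of its TWISTED sector
# energies `tubeEnergy L M Λ e 0 θ`

Companion of `WidthHaldaneTubePlaneWaves.lean` (untwisted floor) and `WidthHaldaneFreeFloor.lean`
(general free-fermion sector floor). The cruxes 16311/16312/18509/18510 read the twist stiffness
`ρ̃_{L,M}` off the sector energies of `tubeH0 + tubeTwist θ` (flux `θ` through the long cycle, seam
phases `-e^{±iθ}` between the columns `-1` and `0`). At `U = 0` these are again free, and this file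
diagonalises them exactly, sorry-free:

* `seam_hop_succ`, `seam_hop_pred` — the quasi-periodic phase `p ↦ e^{i(2πa-θ)p/L}` on representatives
  `p = 0, …, L-1` absorbs the seam phases: hopping forward across the seam costs `e^{-iθ}`, backward
  `e^{+iθ}`, exactly as the twist prescribes (`val` bookkeeping from `WidthHaldaneTubeGauge`);
* `tubeTwist_eq_dGamma` — the twist is the second quantisation of the seam one-body correction, so
  `tubeH0 … 0 + tubeTwist … θ = dΓ(h + T_θ)`;
* `conjTranspose_twistedPlaneWaves_mul_self`, `twistedOneBody_mul_tubeTwistedPlaneWaves` — the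
  twisted mode matrix `V^θ_{(x,σ),(z,τ)} = δ_{στ} e^{i(2πa-θ)p/L} e^{2πibq/M}/√(LM)` (`(a,b) = e z`,
  `(p,q) = e x`; spelled out — it is the `tubeTwistedPlaneWaves` proposed for `WidthHaldaneDefs`) is
  unitary and diagonalises `h + T_θ` with the spin-independent spectrum `tubeTwistedBand L M θ ∘ e`,
  `ε^θ_{L,M}(a,b) = -2cos((2πa-θ)/L) - 2cos(2πb/M)` (`twistedWave_stencil`);
* **`tubeEnergy_free_twisted_eq`** — for `L, M ≥ 3` and every Fermi set `F` of the twisted band,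
  `tubeEnergy L M Λ e 0 θ (2 #F) = 2 Σ_{k∈F} tubeTwistedBand L M θ k`; variational / existence forms
  `tubeEnergy_free_twisted_le`, `exists_fermiSet_tubeEnergy_free_twisted_eq`, and the exact zero-coupling
  stiffness `tubeStiffness_zero_coupling_eq`.

This is the exact `U = 0` value of BOTH sector energies in `tubeStiffness` (θ = 0 and θ = π/3): the
free baseline ("Luttinger zero modes at U = 0", paramagnetic open shells) that every witness of the
stiffness clause of 16312/18510 must beat, now available as a theorem rather than a table
(`Cruxes/WidthUniformThermodynamics` U0-TABLE). Sources: N. Byers, C. N. Yang, PRL 7 (1961) 46;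
D. J. Scalapino, S. R. White, S. C. Zhang, PRB 47 (1993) 7995 §II; BCS (1957) §II. Folklore; no
definitions, no named facts. REUSED: `val_cast_add_one`, `val_cast_of_eq_neg_one` (TubeGauge),
`sum_seam_eq_sum_sum(')`, `sum_adj_tubeGraph`, `tubeChar` algebra, `tubeH0_zero_eq_dGamma`,
`minEnergyOn_dGamma_szSector_eq_of_eigen`.
-/

noncomputable section

namespace Summit.HubbardSuperconductivity.HubbardSuperconductivity.Theorems.WidthHaldane

set_option linter.dupNamespace false -- summit = problem name (single-conjunct summit), D-0017

open scoped BigOperators Classical Matrix ComplexConjugate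
open Matrix Finset Literature.MathematicalPhysics.QuantumLattice

/-! ### The twisted plane waves are orthonormal -/

section TwistedUnitary

variable {L M : ℕ} [NeZero L] [NeZero M] {Λ : Type} [LinearOrder Λ] [Fintype Λ]
  (e : Λ ≃ ZMod L × ZMod M)

/-- Overlap of two twisted phases at one site: `conj e^{i(2πa-θ)p/L} · e^{i(2πa'-θ)p/L} = e_L((a'-a)p)`
(the flux cancels; `ZMod.stdAddChar_coe` on the integer `(a'.val - a.val) p.val`). [folklore] -/
theorem conj_twistPhase_mul_twistPhase (θ : ℝ) (a a' p : ZMod L) :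
    conj (Complex.exp (Complex.I * (((2 * Real.pi * (a.val : ℝ) - θ) * (p.val : ℝ) / L : ℝ) : ℂ))) *
        Complex.exp (Complex.I * (((2 * Real.pi * (a'.val : ℝ) - θ) * (p.val : ℝ) / L : ℝ) : ℂ)) =
      (ZMod.stdAddChar ((a' - a) * p) : ℂ) := by
  have hcast : (a' - a) * p = (((((a'.val : ℤ) - a.val) * p.val : ℤ)) : ZMod L) := by
    push_cast
    simp only [ZMod.natCast_val, ZMod.cast_id', id_eq]
  rw [hcast, ZMod.stdAddChar_coe, ← Complex.exp_conj, ← Complex.exp_add]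
  congr 1
  simp only [map_mul, Complex.conj_I, Complex.conj_ofReal]
  push_cast
  ring

/-- Overlap of two twisted waves at one momentum-site equals the untwisted one:
`conj w^θ_k(q) w^θ_{k'}(q) = conj χ_k(q) χ_{k'}(q)`. [folklore] -/
theorem conj_twistedWave_mul_twistedWave (θ : ℝ) (k k' q : ZMod L × ZMod M) :
    conj (Complex.exp (Complex.I * (((2 * Real.pi * (k.1.val : ℝ) - θ) * (q.1.val : ℝ) / L : ℝ) : ℂ)) *
          (ZMod.stdAddChar (k.2 * q.2) : ℂ)) *
        (Complex.exp (Complex.I * (((2 * Real.pi * (k'.1.val : ℝ) - θ) * (q.1.val : ℝ) / L : ℝ) : ℂ)) *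
          (ZMod.stdAddChar (k'.2 * q.2) : ℂ)) =
      conj (tubeChar L M k q) * tubeChar L M k' q := by
  rw [conj_tubeChar_mul_tubeChar, map_mul, mul_mul_mul_comm, conj_twistPhase_mul_twistPhase, tubeChar,
    Prod.fst_sub, Prod.snd_sub, ← AddChar.map_neg_eq_conj, ← AddChar.map_add_eq_mul]
  congr 2
  ring

/-- **The twisted mode matrix is an isometry (hence unitary)**: `(V^θ)ᴴ V^θ = 1` (orthonormality reduces
to the untwisted characters by `conj_twistedWave_mul_twistedWave`). [folklore] -/
theorem conjTranspose_twistedPlaneWaves_mul_self (θ : ℝ) :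
    (Matrix.of fun o o' : Orb Λ => if (ofLex o).2 = (ofLex o').2 then
        (((Real.sqrt ((L : ℝ) * M))⁻¹ : ℝ) : ℂ) *
          (Complex.exp (Complex.I * (((2 * Real.pi * ((e (ofLex o').1).1.val : ℝ) - θ) *
              ((e (ofLex o).1).1.val : ℝ) / L : ℝ) : ℂ)) *
            (ZMod.stdAddChar ((e (ofLex o').1).2 * (e (ofLex o).1).2) : ℂ)) else 0)ᴴ *
      (Matrix.of fun o o' : Orb Λ => if (ofLex o).2 = (ofLex o').2 then
        (((Real.sqrt ((L : ℝ) * M))⁻¹ : ℝ) : ℂ) *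
          (Complex.exp (Complex.I * (((2 * Real.pi * ((e (ofLex o').1).1.val : ℝ) - θ) *
              ((e (ofLex o).1).1.val : ℝ) / L : ℝ) : ℂ)) *
            (ZMod.stdAddChar ((e (ofLex o').1).2 * (e (ofLex o).1).2) : ℂ)) else 0) = 1 := by
  ext o₁ o₂
  rw [Matrix.mul_apply, Matrix.one_apply, sum_orb_eq_sum_sum]
  simp only [conjTranspose_apply, Matrix.of_apply, orb, ofLex_toLex]
  by_cases hτ : (ofLex o₁).2 = (ofLex o₂).2
  · have hsum : ∀ y : Λ, (∑ σ : Fin 2,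
        star (if σ = (ofLex o₁).2 then (((Real.sqrt ((L : ℝ) * M))⁻¹ : ℝ) : ℂ) *
            (Complex.exp (Complex.I * (((2 * Real.pi * ((e (ofLex o₁).1).1.val : ℝ) - θ) *
              ((e y).1.val : ℝ) / L : ℝ) : ℂ)) * (ZMod.stdAddChar ((e (ofLex o₁).1).2 * (e y).2) : ℂ)) else 0) *
          (if σ = (ofLex o₂).2 then (((Real.sqrt ((L : ℝ) * M))⁻¹ : ℝ) : ℂ) *
            (Complex.exp (Complex.I * (((2 * Real.pi * ((e (ofLex o₂).1).1.val : ℝ) - θ) *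
              ((e y).1.val : ℝ) / L : ℝ) : ℂ)) * (ZMod.stdAddChar ((e (ofLex o₂).1).2 * (e y).2) : ℂ)) else 0)) =
        (((Real.sqrt ((L : ℝ) * M))⁻¹ : ℝ) : ℂ) * (((Real.sqrt ((L : ℝ) * M))⁻¹ : ℝ) : ℂ) *
          (conj (tubeChar L M (e (ofLex o₁).1) (e y)) * tubeChar L M (e (ofLex o₂).1) (e y)) := by
      intro y
      rw [Finset.sum_eq_single (ofLex o₁).2]
      · rw [if_pos rfl, if_pos hτ, star_mul', Complex.star_def, Complex.conj_ofReal,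
          ← conj_twistedWave_mul_twistedWave θ (e (ofLex o₁).1) (e (ofLex o₂).1) (e y)]
        ring
      · intro σ _ hσ
        rw [if_neg hσ, star_zero, zero_mul]
      · intro h; exact absurd (mem_univ _) h
    simp_rw [hsum]
    rw [← Finset.mul_sum, show (∑ y : Λ, conj (tubeChar L M (e (ofLex o₁).1) (e y)) * tubeChar L M (e (ofLex o₂).1) (e y)) =
        ∑ p : ZMod L × ZMod M, conj (tubeChar L M (e (ofLex o₁).1) p) * tubeChar L M (e (ofLex o₂).1) p from
      e.sum_comp (fun p => conj (tubeChar L M (e (ofLex o₁).1) p) * tubeChar L M (e (ofLex o₂).1) p),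
      sum_conj_tubeChar_mul_tubeChar]
    have ho : o₁ = o₂ ↔ e (ofLex o₁).1 = e (ofLex o₂).1 := by
      rw [e.apply_eq_iff_eq]
      constructor
      · rintro rfl; rfl
      · intro h
        apply ofLex.injective
        exact Prod.ext h hτ
    by_cases h12 : o₁ = o₂
    · rw [if_pos h12, if_pos (ho.1 h12)]
      exact_mod_cast sqrt_inv_mul_self_mul (L := L) (M := M)
    · rw [if_neg h12, if_neg (fun h => h12 (ho.2 h)), mul_zero]
  · rw [if_neg (fun h => hτ (by rw [h]))]
    refine Finset.sum_eq_zero fun y _ => Finset.sum_eq_zero fun σ _ => ?_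
    by_cases h1 : σ = (ofLex o₁).2
    · rw [if_neg (fun h2 => hτ (h1.symm.trans h2)), mul_zero]
    · rw [if_neg h1, star_zero, zero_mul]

end TwistedUnitary


/-! ### The twisted plane waves diagonalise the twisted hopping matrix -/

section TwistedEigen

variable {L M : ℕ} [NeZero L] [NeZero M] {Λ : Type} [LinearOrder Λ] [Fintype Λ]
  (e : Λ ≃ ZMod L × ZMod M)

/-- `e^{ix} + e^{-ix} = 2cos x` for real `x`. [folklore] -/
theorem exp_I_add_exp_neg_I (x : ℝ) :
    Complex.exp (Complex.I * (x : ℂ)) + Complex.exp (-(Complex.I * (x : ℂ))) = ((2 * Real.cos x : ℝ) : ℂ) := by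
  push_cast; rw [Complex.two_cos]; ring_nf

/-- **The twisted stencil.** With the seam indicators of `h + T_θ` as coefficients, the four
neighbour values of the twisted wave `w^θ_k` sum to `-ε^θ_{L,M}(k) w^θ_k(p)`,
`ε^θ_{L,M} = tubeTwistedBand`. Byers–Yang (1961); Scalapino–White–Zhang (1993) §II. [folklore] -/
theorem twistedWave_stencil (hL : 3 ≤ L) (θ : ℝ) (k p : ZMod L × ZMod M) :
    (if p.1 = -1 then Complex.exp (-(Complex.I * θ)) else 1) *
          (Complex.exp (Complex.I * (((2 * Real.pi * (k.1.val : ℝ) - θ) * ((p + (1, 0)).1.val : ℝ) / L : ℝ) : ℂ)) *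
            (ZMod.stdAddChar (k.2 * (p + (1, 0)).2) : ℂ)) +
        (if p.1 = 0 then Complex.exp (Complex.I * θ) else 1) *
          (Complex.exp (Complex.I * (((2 * Real.pi * (k.1.val : ℝ) - θ) * ((p - (1, 0)).1.val : ℝ) / L : ℝ) : ℂ)) *
            (ZMod.stdAddChar (k.2 * (p - (1, 0)).2) : ℂ)) +
        Complex.exp (Complex.I * (((2 * Real.pi * (k.1.val : ℝ) - θ) * ((p + (0, 1)).1.val : ℝ) / L : ℝ) : ℂ)) *
          (ZMod.stdAddChar (k.2 * (p + (0, 1)).2) : ℂ) +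
        Complex.exp (Complex.I * (((2 * Real.pi * (k.1.val : ℝ) - θ) * ((p - (0, 1)).1.val : ℝ) / L : ℝ) : ℂ)) *
          (ZMod.stdAddChar (k.2 * (p - (0, 1)).2) : ℂ) =
      Complex.exp (Complex.I * (((2 * Real.pi * (k.1.val : ℝ) - θ) * (p.1.val : ℝ) / L : ℝ) : ℂ)) *
        (ZMod.stdAddChar (k.2 * p.2) : ℂ) * ((-(tubeTwistedBand L M θ k) : ℝ) : ℂ) := by
  simp only [Prod.fst_add, Prod.snd_add, Prod.fst_sub, Prod.snd_sub, add_zero, sub_zero]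
  have h1 := seam_hop_succ hL θ k.1 p.1
  have h2 := seam_hop_pred hL θ k.1 p.1
  have h3 : (ZMod.stdAddChar (k.2 * (p.2 + 1)) : ℂ) = ZMod.stdAddChar (k.2 * p.2) * ZMod.stdAddChar k.2 := by
    rw [mul_add, mul_one, AddChar.map_add_eq_mul]
  have h4 : (ZMod.stdAddChar (k.2 * (p.2 - 1)) : ℂ) = ZMod.stdAddChar (k.2 * p.2) * ZMod.stdAddChar (-k.2) := by
    rw [mul_sub, mul_one, sub_eq_add_neg, AddChar.map_add_eq_mul]
  have h5 := exp_I_add_exp_neg_I ((2 * Real.pi * (k.1.val : ℝ) - θ) / L)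
  have h6 := stdAddChar_add_stdAddChar_neg k.2
  rw [tubeTwistedBand, h3, h4]
  push_cast at h1 h2 h5 h6 ⊢
  set Φ := Complex.exp (Complex.I * ((2 * Real.pi * (k.1.val : ℂ) - θ) * (p.1.val : ℂ) / L)) with hΦ
  set u := Complex.exp (Complex.I * ((2 * Real.pi * (k.1.val : ℂ) - θ) / L)) with hu
  linear_combination (ZMod.stdAddChar (k.2 * p.2) : ℂ) * h1 + (ZMod.stdAddChar (k.2 * p.2) : ℂ) * h2 +
    Φ * (ZMod.stdAddChar (k.2 * p.2) : ℂ) * h5 + Φ * (ZMod.stdAddChar (k.2 * p.2) : ℂ) * h6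

omit [NeZero L] [NeZero M] in
/-- The backward seam indicator summed over the partner: nonzero only on column `-1`. [folklore] -/
theorem sum_seam_B {β : Type*} [AddCommMonoid β] (g : Λ → β) (x : Λ) :
    ∑ y : Λ, (if (e y).1 = 0 ∧ x = e.symm (-1, (e y).2) then g y else 0) =
      if (e x).1 = -1 then g (e.symm (0, (e x).2)) else 0 := by
  have hiff : ∀ y : Λ, ((e y).1 = 0 ∧ x = e.symm (-1, (e y).2)) ↔ ((e x).1 = -1 ∧ y = e.symm (0, (e x).2)) := by
    intro y
    constructor
    · rintro ⟨h0, hx⟩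
      have hex : e x = (-1, (e y).2) := by rw [hx, Equiv.apply_symm_apply]
      refine ⟨by rw [hex], ?_⟩
      rw [Equiv.eq_symm_apply, hex]
      exact Prod.ext h0 rfl
    · rintro ⟨h1, hy⟩
      have hey : e y = (0, (e x).2) := by rw [hy, Equiv.apply_symm_apply]
      refine ⟨by rw [hey], ?_⟩
      rw [Equiv.eq_symm_apply, hey]
      exact Prod.ext h1 rfl
  simp_rw [if_congr (hiff _) rfl rfl]
  by_cases h1 : (e x).1 = -1
  · simp only [h1, true_and, Finset.sum_ite_eq', Finset.mem_univ, if_true]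
  · simp [h1]

omit [NeZero L] [NeZero M] in
/-- The forward seam indicator summed over the partner: nonzero only on column `0`. [folklore] -/
theorem sum_seam_A {β : Type*} [AddCommMonoid β] (g : Λ → β) (x : Λ) :
    ∑ y : Λ, (if (e x).1 = 0 ∧ y = e.symm (-1, (e x).2) then g y else 0) =
      if (e x).1 = 0 then g (e.symm (-1, (e x).2)) else 0 := by
  by_cases h0 : (e x).1 = 0
  · simp only [h0, true_and, Finset.sum_ite_eq', Finset.mem_univ, if_true]
  · simp [h0]

/-- **The twisted plane waves diagonalise the twisted hopping matrix** (`L, M ≥ 3`):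
`(h + T_θ) V^θ = V^θ diag(ε^θ_{L,M} ∘ e ∘ site)`, `h = hubbardOneBody (tubeGraph e) 1 0`, `T_θ` the seam
correction of `tubeTwist_eq_dGamma`. [folklore] -/
theorem twistedOneBody_mul_tubeTwistedPlaneWaves (hL : 3 ≤ L) (hM : 3 ≤ M) (θ : ℝ) :
    (hubbardOneBody (tubeGraph e) 1 0 + Matrix.of fun o o' : Orb Λ =>
      if (ofLex o).2 = (ofLex o').2 then
        ((if (e (ofLex o).1).1 = 0 ∧ (ofLex o').1 = e.symm (-1, (e (ofLex o).1).2) then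
            (1 - Complex.exp (Complex.I * θ)) else 0) +
          (if (e (ofLex o').1).1 = 0 ∧ (ofLex o).1 = e.symm (-1, (e (ofLex o').1).2) then
            (1 - Complex.exp (-(Complex.I * θ))) else 0))
      else 0) *
        (Matrix.of fun o o' : Orb Λ => if (ofLex o).2 = (ofLex o').2 then
        (((Real.sqrt ((L : ℝ) * M))⁻¹ : ℝ) : ℂ) *
          (Complex.exp (Complex.I * (((2 * Real.pi * ((e (ofLex o').1).1.val : ℝ) - θ) *
              ((e (ofLex o).1).1.val : ℝ) / L : ℝ) : ℂ)) *
            (ZMod.stdAddChar ((e (ofLex o').1).2 * (e (ofLex o).1).2) : ℂ)) else 0) =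
      (Matrix.of fun o o' : Orb Λ => if (ofLex o).2 = (ofLex o').2 then
        (((Real.sqrt ((L : ℝ) * M))⁻¹ : ℝ) : ℂ) *
          (Complex.exp (Complex.I * (((2 * Real.pi * ((e (ofLex o').1).1.val : ℝ) - θ) *
              ((e (ofLex o).1).1.val : ℝ) / L : ℝ) : ℂ)) *
            (ZMod.stdAddChar ((e (ofLex o').1).2 * (e (ofLex o).1).2) : ℂ)) else 0) *
        diagonal fun o => ((tubeTwistedBand L M θ (e (ofLex o).1) : ℝ) : ℂ) := by
  set T : Matrix (Orb Λ) (Orb Λ) ℂ := Matrix.of fun o o' : Orb Λ =>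
      if (ofLex o).2 = (ofLex o').2 then
        ((if (e (ofLex o).1).1 = 0 ∧ (ofLex o').1 = e.symm (-1, (e (ofLex o).1).2) then
            (1 - Complex.exp (Complex.I * θ)) else 0) +
          (if (e (ofLex o').1).1 = 0 ∧ (ofLex o).1 = e.symm (-1, (e (ofLex o').1).2) then
            (1 - Complex.exp (-(Complex.I * θ))) else 0))
      else 0 with hT
  have T_apply : ∀ (x : Λ) (σ : Fin 2) (y : Λ) (τ : Fin 2), T (orb x σ) (orb y τ) =
      if σ = τ then
        ((if (e x).1 = 0 ∧ y = e.symm (-1, (e x).2) then (1 - Complex.exp (Complex.I * θ)) else 0) +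
          (if (e y).1 = 0 ∧ x = e.symm (-1, (e y).2) then (1 - Complex.exp (-(Complex.I * θ))) else 0))
      else 0 := fun _ _ _ _ => rfl
  -- the twisted wave of momentum `e z` at the momentum `q`, without normalisation
  set W : Λ → (ZMod L × ZMod M) → ℂ := fun z q =>
    Complex.exp (Complex.I * (((2 * Real.pi * ((e z).1.val : ℝ) - θ) * (q.1.val : ℝ) / L : ℝ) : ℂ)) *
      (ZMod.stdAddChar ((e z).2 * q.2) : ℂ) with hW
  set w : ℂ := (((Real.sqrt ((L : ℝ) * M))⁻¹ : ℝ) : ℂ) with hw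
  set V : Matrix (Orb Λ) (Orb Λ) ℂ := (Matrix.of fun o o' : Orb Λ => if (ofLex o).2 = (ofLex o').2 then
        (((Real.sqrt ((L : ℝ) * M))⁻¹ : ℝ) : ℂ) *
          (Complex.exp (Complex.I * (((2 * Real.pi * ((e (ofLex o').1).1.val : ℝ) - θ) *
              ((e (ofLex o).1).1.val : ℝ) / L : ℝ) : ℂ)) *
            (ZMod.stdAddChar ((e (ofLex o').1).2 * (e (ofLex o).1).2) : ℂ)) else 0) with hV
  have V_apply : ∀ (y : Λ) (σ : Fin 2) (z : Λ) (τ : Fin 2),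
      V (orb y σ) (orb z τ) = if σ = τ then w * W z (e y) else 0 := by
    intro y σ z τ
    simp only [hV, Matrix.of_apply, orb, ofLex_toLex, hW, hw, mul_assoc]
  ext o o'
  obtain ⟨x, σ⟩ := o
  obtain ⟨z, τ⟩ := o'
  change ((hubbardOneBody (tubeGraph e) 1 0 + T) * V) (orb x σ) (orb z τ) =
    (V * diagonal fun o : Orb Λ => ((tubeTwistedBand L M θ (e (ofLex o).1) : ℝ) : ℂ)) (orb x σ) (orb z τ)
  rw [mul_diagonal, Matrix.mul_apply, sum_orb_eq_sum_sum, V_apply]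
  simp only [Matrix.add_apply, hubbardOneBody_apply, T_apply, V_apply, orb, ofLex_toLex, Complex.ofReal_zero,
    Complex.ofReal_one, ite_self, sub_zero]
  -- collapse the spin sums
  have hsum : ∀ y : Λ, (∑ σ'' : Fin 2,
      ((if (tubeGraph e).Adj x y ∧ σ = σ'' then (-1 : ℂ) else 0) +
          (if σ = σ'' then
            ((if (e x).1 = 0 ∧ y = e.symm (-1, (e x).2) then (1 - Complex.exp (Complex.I * θ)) else 0) +
              (if (e y).1 = 0 ∧ x = e.symm (-1, (e y).2) then (1 - Complex.exp (-(Complex.I * θ))) else 0))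
          else 0)) * (if σ'' = τ then w * W z (e y) else 0)) =
      if σ = τ then
        ((if (tubeGraph e).Adj x y then -(w * W z (e y)) else 0) +
          (if (e x).1 = 0 ∧ y = e.symm (-1, (e x).2) then (1 - Complex.exp (Complex.I * θ)) * (w * W z (e y)) else 0) +
          (if (e y).1 = 0 ∧ x = e.symm (-1, (e y).2) then (1 - Complex.exp (-(Complex.I * θ))) * (w * W z (e y)) else 0))
      else 0 := by
    intro y
    rw [Finset.sum_eq_single σ]
    · by_cases hστ : σ = τ
      · simp only [hστ, and_true, if_true]
        split_ifs <;> ring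
      · simp only [hστ, if_false, mul_zero]
    · intro σ'' _ hσ
      rw [if_neg (fun h => hσ h.2.symm), if_neg (Ne.symm hσ), zero_add, zero_mul]
    · intro h; exact absurd (mem_univ _) h
  simp_rw [hsum]
  by_cases hστ : σ = τ
  · simp_rw [if_pos hστ]
    rw [Finset.sum_add_distrib, Finset.sum_add_distrib, sum_adj_tubeGraph e hL hM,
      sum_seam_A e (fun y => (1 - Complex.exp (Complex.I * θ)) * (w * W z (e y))) x,
      sum_seam_B e (fun y => (1 - Complex.exp (-(Complex.I * θ))) * (w * W z (e y))) x]
    simp only [Equiv.apply_symm_apply]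
    -- rewrite the seam momenta as `e x ∓ e₁`
    have hA : (if (e x).1 = 0 then (1 - Complex.exp (Complex.I * θ)) * (w * W z (-1, (e x).2)) else 0) =
        (if (e x).1 = 0 then (1 - Complex.exp (Complex.I * θ)) else 0) * (w * W z (e x - (1, 0))) := by
      by_cases h0 : (e x).1 = 0
      · rw [if_pos h0, if_pos h0]
        congr 3
        ext <;> simp [h0]
      · rw [if_neg h0, if_neg h0, zero_mul]
    have hB : (if (e x).1 = -1 then (1 - Complex.exp (-(Complex.I * θ))) * (w * W z (0, (e x).2)) else 0) =
        (if (e x).1 = -1 then (1 - Complex.exp (-(Complex.I * θ))) else 0) * (w * W z (e x + (1, 0))) := by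
      by_cases h1 : (e x).1 = -1
      · rw [if_pos h1, if_pos h1]
        congr 3
        ext <;> simp [h1]
      · rw [if_neg h1, if_neg h1, zero_mul]
    rw [hA, hB]
    have hst := twistedWave_stencil (M := M) hL θ (e z) (e x)
    simp only [hW] at hst ⊢
    -- match the `ite` coefficients of the stencil
    have c1 : (if (e x).1 = -1 then (1 - Complex.exp (-(Complex.I * θ))) else (0 : ℂ)) =
        1 - (if (e x).1 = -1 then Complex.exp (-(Complex.I * θ)) else 1) := by split_ifs <;> ring
    have c2 : (if (e x).1 = 0 then (1 - Complex.exp (Complex.I * θ)) else (0 : ℂ)) =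
        1 - (if (e x).1 = 0 then Complex.exp (Complex.I * θ) else 1) := by split_ifs <;> ring
    rw [c1, c2]
    push_cast at hst ⊢
    linear_combination (-w) * hst
  · simp_rw [if_neg hστ]
    rw [Finset.sum_const_zero, zero_mul]

/-- **The free floor of the TWISTED rectangular tube.** For `L, M ≥ 3`, every carrier and every Fermi
set `F` of the twisted band `ε^θ_{L,M}` (`≤ μ` on `F`, `μ ≤` off `F`):
`tubeEnergy L M Λ e 0 θ (2 #F) = 2 Σ_{k∈F} tubeTwistedBand L M θ k` — the exact `U = 0` value of the
twisted sector energies entering `tubeStiffness`. Byers–Yang (1961); BCS (1957) §II. [folklore] -/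
theorem tubeEnergy_free_twisted_eq (hL : 3 ≤ L) (hM : 3 ≤ M) (θ : ℝ) (F : Finset (ZMod L × ZMod M)) (μ : ℝ)
    (hF : ∀ k ∈ F, tubeTwistedBand L M θ k ≤ μ) (hF' : ∀ k ∉ F, μ ≤ tubeTwistedBand L M θ k) :
    tubeEnergy L M Λ e 0 θ (2 * F.card) = 2 * ∑ k ∈ F, tubeTwistedBand L M θ k := by
  set F' : Finset Λ := F.map e.symm.toEmbedding with hF'def
  have hcard : F'.card = F.card := Finset.card_map _
  have hmem : ∀ x : Λ, x ∈ F' ↔ e x ∈ F := fun x => by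
    rw [hF'def, Finset.mem_map_equiv]
    simp
  have hsumF : ∑ x ∈ F', tubeTwistedBand L M θ (e x) = ∑ k ∈ F, tubeTwistedBand L M θ k := by
    rw [hF'def, Finset.sum_map]
    simp
  rw [tubeEnergy_eq, tubeH0_zero_eq_dGamma, tubeTwist_eq_dGamma, ← dGamma_add, ← hcard, ← hsumF]
  exact minEnergyOn_dGamma_szSector_eq_of_eigen _ _
    (conjTranspose_twistedPlaneWaves_mul_self e θ) (fun o o' h => by rw [Matrix.of_apply, if_neg h])
    (fun x => tubeTwistedBand L M θ (e x)) (twistedOneBody_mul_tubeTwistedPlaneWaves e hL hM θ) F' μ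
    (fun x hx => hF (e x) ((hmem x).1 hx)) (fun x hx => hF' (e x) (fun h => hx ((hmem x).2 h)))

/-- **Variational form**: at `U = 0` the twisted sector energy of `2 #T` electrons is at most the paired
energy of ANY momentum set `T` (a Fermi set of the same size exists, `exists_fermiSet`, and minimises
the band sum, `sum_fermiSet_le_sum`). In particular (`T` = the untwisted Fermi sea) this is the free
PARAMAGNETIC/diamagnetic comparison that decides the sign of `tubeStiffness` at `U = 0`. [folklore] -/
theorem tubeEnergy_free_twisted_le (hL : 3 ≤ L) (hM : 3 ≤ M) (θ : ℝ) (T : Finset (ZMod L × ZMod M)) :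
    tubeEnergy L M Λ e 0 θ (2 * T.card) ≤ 2 * ∑ k ∈ T, tubeTwistedBand L M θ k := by
  obtain ⟨F, μ, hc, hF, hF'⟩ := exists_fermiSet (tubeTwistedBand L M θ) (n := T.card)
    (by rw [← Finset.card_univ]; exact Finset.card_le_card (Finset.subset_univ T))
  rw [← hc, tubeEnergy_free_twisted_eq e hL hM θ F μ hF hF']
  have h := sum_fermiSet_le (tubeTwistedBand L M θ) (fun k => if k ∈ T then (1 : ℝ) else 0) F μ hF hF'
    (fun k => by positivity) (fun k => by split_ifs <;> norm_num)
    (by rw [Finset.sum_boole, Finset.filter_mem_eq_inter, Finset.univ_inter, hc])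
  simp only [mul_ite, mul_one, mul_zero, Finset.sum_ite_mem, Finset.univ_inter] at h
  linarith

/-- **Existence form**: for every pair number `n ≤ LM` the twisted `U = 0` sector energy IS the paired
energy of a Fermi set of the twisted band. [folklore] -/
theorem exists_fermiSet_tubeEnergy_free_twisted_eq (hL : 3 ≤ L) (hM : 3 ≤ M) (θ : ℝ) {n : ℕ}
    (hn : n ≤ L * M) :
    ∃ (F : Finset (ZMod L × ZMod M)) (μ : ℝ), F.card = n ∧ (∀ k ∈ F, tubeTwistedBand L M θ k ≤ μ) ∧
      (∀ k ∉ F, μ ≤ tubeTwistedBand L M θ k) ∧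
      tubeEnergy L M Λ e 0 θ (2 * n) = 2 * ∑ k ∈ F, tubeTwistedBand L M θ k := by
  obtain ⟨F, μ, hc, hF, hF'⟩ := exists_fermiSet (tubeTwistedBand L M θ) (n := n)
    (by rw [Fintype.card_prod, ZMod.card, ZMod.card]; exact hn)
  exact ⟨F, μ, hc, hF, hF', by rw [← hc, tubeEnergy_free_twisted_eq e hL hM θ F μ hF hF']⟩

/-- **The twist stiffness at zero coupling, exactly.** With Fermi sets `F₀` of the free band (`θ = 0`,
`tubeTwistedBand_zero`) and `F₁` of the twisted band at `θ₀ = π/3`, both of the pair number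
`n = N_{L,M}(δ)/2`: `ρ̃_{L,M}(0, δ) = 2L · (2Σ_{F₁} ε^{π/3} − 2Σ_{F₀} ε) / ((π/3)² M)` — the free
(paramagnetic-shell) baseline of the stiffness clause of 16312/18510. [folklore] -/
theorem tubeStiffness_zero_coupling_eq (hL : 3 ≤ L) (hM : 3 ≤ M) {δ : ℝ} {n : ℕ}
    (hN : tubeFilling L M δ = 2 * n) {F₀ F₁ : Finset (ZMod L × ZMod M)} {μ₀ μ₁ : ℝ}
    (h₀ : F₀.card = n) (hF₀ : ∀ k ∈ F₀, tubeBand L M k ≤ μ₀) (hF₀' : ∀ k ∉ F₀, μ₀ ≤ tubeBand L M k)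
    (h₁ : F₁.card = n) (hF₁ : ∀ k ∈ F₁, tubeTwistedBand L M (Real.pi / 3) k ≤ μ₁)
    (hF₁' : ∀ k ∉ F₁, μ₁ ≤ tubeTwistedBand L M (Real.pi / 3) k) :
    tubeStiffness L M Λ e 0 δ =
      2 * (L : ℝ) * (2 * ∑ k ∈ F₁, tubeTwistedBand L M (Real.pi / 3) k - 2 * ∑ k ∈ F₀, tubeBand L M k) /
        ((Real.pi / 3) ^ 2 * (M : ℝ)) := by
  rw [tubeStiffness, hN]
  conv_lhs => rw [← h₁]
  rw [tubeEnergy_free_twisted_eq e hL hM (Real.pi / 3) F₁ μ₁ hF₁ hF₁', h₁, ← h₀,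
    tubeEnergy_free_eq e hL hM F₀ μ₀ hF₀ hF₀']

end TwistedEigen

end Summit.HubbardSuperconductivity.HubbardSuperconductivity.Theorems.WidthHaldane

end
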